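import Summits.ValiantsHypothesis.ValiantsHypothesis.Theorems.NewtonUnitEquationsTwoProductsConfinedTameLawCount
import Summits.ValiantsHypothesis.ValiantsHypothesis.Theorems.NewtonUnitEquationsTwoProductsConfinedTameLawArith
import Summits.ValiantsHypothesis.ValiantsHypothesis.Theorems.NewtonUnitEquationsTwoProductsFormalLogLinearisationStubLogLinearisation
import Summits.ValiantsHypothesis.ValiantsHypothesis.Theorems.NewtonUnitEquationsTwoProductsConfinedTameLawDefs
import HarnessLib

/-!
# R10 (`positive-circuit-chart`) — F7b: the BRIDGE to the rung statement and `R10Defs.ConfinedTameLaw C`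
Imports the rung's definitions (`…ConfinedTameLawDefs`, ns `R10Defs`, texts = val-idea-37 g0).  Bridge: `R10Defs.LetterConfined` ⇒ index-level confinement of `relLat`; `R10Defs.FibreSpread` ⇒ index-level
pattern spread; `IsCellFamily` ⇒ visible-set form (`stub_logLinearisation`); `sE ≤ 2mt`; then `confinedCount` + `arith_R10`.
R275 P3 scope: proper positive sub-case rung; nothing here closes 5906; VP ≠ VNP is NOT proved.
-/

noncomputable section
set_option linter.dupNamespace false
set_option linter.unusedSectionVars false

/-! ## Bridge and the rung -/
namespace Summit.ValiantsHypothesis.ValiantsHypothesis.Theorems.NewtonUnitEquations.TwoProducts.PermutationType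
namespace R10
open scoped BigOperators
open MvPolynomial
open Summit.ValiantsHypothesis.ValiantsHypothesis.Theorems.NewtonUnitEquations.TwoProducts.FormalLogLinearisation
open Summit.ValiantsHypothesis.ValiantsHypothesis.Theorems.NewtonUnitEquations.TwoProducts.PlanarCell

section Bridge
variable {m : ℕ} (u v : Fin m → MvPolynomial (Fin 2) ℂ)

/-- The tail alphabet has at most `2mt` letters. [folklore] -/
theorem sE_le (t : ℕ) (hu : ∀ j, (u j).support.card ≤ t) (hv : ∀ j, (v j).support.card ≤ t) : sE u v ≤ 2 * m * t := by
  classical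
  unfold sE tailSupport
  calc _ ≤ (Finset.univ.biUnion fun j => (u j).support).card + (Finset.univ.biUnion fun j => (v j).support).card :=
        Finset.card_union_le _ _
    _ ≤ ∑ j : Fin m, (u j).support.card + ∑ j : Fin m, (v j).support.card :=
        Nat.add_le_add Finset.card_biUnion_le Finset.card_biUnion_le
    _ ≤ ∑ _j : Fin m, t + ∑ _j : Fin m, t := Nat.add_le_add (Finset.sum_le_sum fun j _ => hu j) (Finset.sum_le_sum fun j _ => hv j)
    _ = 2 * m * t := by simp; ring

/-- Chain exponents are realised by tuples (both products). [folklore] -/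
theorem tuple_of_mem_support_liftG (hu : ∀ j, coeff 0 (u j) = 0) (hv : ∀ j, coeff 0 (v j) = 0) (κ : Fin (sE u v) →₀ ℕ)
    (hκ : κ ∈ (liftG (cU u v) (cV u v)).support) :
    ∃ a ∈ tuples (fun j => (u j).support ∪ (v j).support), ∑ j, a j = piE (enum u v) κ ∧ msetT a = Finsupp.mapDomain (enum u v) κ := by
  classical
  have hcU : ∀ j i, cU u v j i ≠ 0 → enum u v i ∈ (u j).support ∪ (v j).support := fun j i h =>
    Finset.mem_union_left _ (mem_support_iff.mpr h)
  have hcV : ∀ j i, cV u v j i ≠ 0 → enum u v i ∈ (u j).support ∪ (v j).support := fun j i h =>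
    Finset.mem_union_right _ (mem_support_iff.mpr h)
  unfold liftG at hκ
  rcases Finset.mem_union.1 (support_sub _ _ _ hκ) with h | h
  · exact tuple_of_mem_support_prod u v hu hv _ (cU u v) hcU κ h
  · exact tuple_of_mem_support_prod u v hu hv _ (cV u v) hcV κ h

/-- Reading a letter vector through the enumeration. [folklore] -/
theorem mapDomain_enum_apply (κ : Fin (sE u v) →₀ ℕ) (k : Fin (sE u v)) :
    Finsupp.mapDomain (enum u v) κ (enum u v k) = κ k :=
  Finsupp.mapDomain_apply (enum_injective u v) κ k

/-- **R10Defs.LetterConfined ⇒ index-level confinement of `relLat`.** [folklore] -/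
theorem conf_of_letterConfined (hu : ∀ j, coeff 0 (u j) = 0) (hv : ∀ j, coeff 0 (v j) = 0) (L : Finset Expo)
    (hLC : R10Defs.LetterConfined (fun j => (u j).support ∪ (v j).support) L) :
    ∀ z ∈ relLat u v, ∀ k, enum u v k ∉ L → z k = 0 := by
  intro z hz k hk
  unfold relLat at hz
  induction hz using Submodule.span_induction with
  | mem x hx =>
    obtain ⟨L1, L2, hL1, hL2, hπ, rfl⟩ := hx
    obtain ⟨a, ha, haS, haM⟩ := tuple_of_mem_support_liftG u v hu hv L1 hL1
    obtain ⟨b, hb, hbS, hbM⟩ := tuple_of_mem_support_liftG u v hu hv L2 hL2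
    have h := hLC a ha b hb (by rw [haS, hbS, hπ]) (enum u v k) hk
    rw [haM, hbM, mapDomain_enum_apply, mapDomain_enum_apply] at h
    simp [tableZ, h]
  | zero => simp
  | add a b _ _ ha hb => simp [ha, hb]
  | smul n a _ ha => simp [ha]

/-- The index-to-letter transport of integer vectors: `z ↦ Σ_k z k • δ_{enum k}`. [folklore] -/
def toExpoZ (z : Fin (sE u v) → ℤ) : Expo →₀ ℤ := ∑ k, z k • Finsupp.single (enum u v k) 1

/-- The transport is additive. [folklore] -/
theorem toExpoZ_add (z z' : Fin (sE u v) → ℤ) : toExpoZ u v (z + z') = toExpoZ u v z + toExpoZ u v z' := by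
  unfold toExpoZ; rw [← Finset.sum_add_distrib]
  exact Finset.sum_congr rfl fun k _ => by rw [Pi.add_apply, add_smul]

/-- The transport is homogeneous. [folklore] -/
theorem toExpoZ_smul (n : ℤ) (z : Fin (sE u v) → ℤ) : toExpoZ u v (n • z) = n • toExpoZ u v z := by
  unfold toExpoZ; rw [Finset.smul_sum]
  exact Finset.sum_congr rfl fun k _ => by rw [Pi.smul_apply, smul_eq_mul, mul_smul]

/-- The transport of a table is `R10Defs.toZ` of the pushed-forward multiset. [folklore] -/
theorem toExpoZ_tableZ (κ : Fin (sE u v) →₀ ℕ) : toExpoZ u v (tableZ u v κ) = R10Defs.toZ (Finsupp.mapDomain (enum u v) κ) := by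
  classical
  unfold toExpoZ R10Defs.toZ tableZ
  ext e
  rw [Finsupp.coe_finsetSum, Finset.sum_apply, Finsupp.mapRange_apply]
  by_cases he : ∃ k, enum u v k = e
  · obtain ⟨k, rfl⟩ := he
    rw [mapDomain_enum_apply, Finset.sum_eq_single k]
    · simp
    · intro k' _ hk'
      have : enum u v k' ≠ enum u v k := fun h => hk' (enum_injective u v h)
      simp [this]
    · intro h; exact absurd (Finset.mem_univ k) h
  · push Not at he
    rw [Finsupp.mapDomain_notin_range]
    · simp only [Nat.cast_zero]
      exact Finset.sum_eq_zero fun k _ => by simp [he k]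
    · rintro ⟨k, hk⟩; exact he k hk

/-- `relLat` maps into the realised relation lattice of the card. [folklore] -/
theorem toExpoZ_mem_relLattice (hu : ∀ j, coeff 0 (u j) = 0) (hv : ∀ j, coeff 0 (v j) = 0) (z : Fin (sE u v) → ℤ)
    (hz : z ∈ relLat u v) : toExpoZ u v z ∈ R10Defs.relLattice (fun j => (u j).support ∪ (v j).support) := by
  unfold relLat at hz
  unfold R10Defs.relLattice
  induction hz using Submodule.span_induction with
  | mem x hx =>
    obtain ⟨L1, L2, hL1, hL2, hπ, rfl⟩ := hx
    obtain ⟨a, ha, haS, haM⟩ := tuple_of_mem_support_liftG u v hu hv L1 hL1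
    obtain ⟨b, hb, hbS, hbM⟩ := tuple_of_mem_support_liftG u v hu hv L2 hL2
    refine Submodule.subset_span ⟨a, ha, b, hb, by rw [haS, hbS, hπ], ?_⟩
    rw [show tableZ u v L1 - tableZ u v L2 = tableZ u v L1 + (-1 : ℤ) • tableZ u v L2 by
      funext i; simp only [Pi.add_apply, Pi.sub_apply, Pi.smul_apply, smul_eq_mul]; ring, toExpoZ_add, toExpoZ_smul, toExpoZ_tableZ, toExpoZ_tableZ, haM, hbM, neg_one_smul,
      ← sub_eq_add_neg]
  | zero => unfold toExpoZ; simp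
  | add a b _ _ ha hb => rw [toExpoZ_add]; exact Submodule.add_mem _ ha hb
  | smul n a _ ha => rw [toExpoZ_smul]; exact Submodule.smul_mem _ n ha

/-- Filtering commutes with the injective push-forward of a letter vector. [folklore] -/
theorem mapDomain_lpP (L : Finset Expo) (κ : Fin (sE u v) →₀ ℕ) :
    Finsupp.mapDomain (enum u v) (lpP (Finset.univ.filter fun k => enum u v k ∈ L) κ) =
      (Finsupp.mapDomain (enum u v) κ).filter (· ∈ L) := by
  classical
  ext e
  rw [Finsupp.filter_apply]
  by_cases he : ∃ k, enum u v k = e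
  · obtain ⟨k, rfl⟩ := he
    rw [mapDomain_enum_apply, mapDomain_enum_apply, lpP_apply]
    simp
  · push Not at he
    have hr : e ∉ Set.range (enum u v) := by rintro ⟨k, hk⟩; exact he k hk
    rw [Finsupp.mapDomain_notin_range _ _ hr, Finsupp.mapDomain_notin_range _ _ hr]
    simp

/-- **R10Defs.FibreSpread ⇒ index-level pattern spread.** [folklore] -/
theorem spread_of_fibreSpread (hu : ∀ j, coeff 0 (u j) = 0) (hv : ∀ j, coeff 0 (v j) = 0) (L : Finset Expo) (Δ : ℕ)
    (hFS : R10Defs.FibreSpread (fun j => (u j).support ∪ (v j).support) L Δ) :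
    ∀ Lx ∈ (liftG (cU u v) (cV u v)).support, ∀ b : Fin (sE u v) →₀ ℕ,
      (∀ k, k ∉ (Finset.univ.filter fun k => enum u v k ∈ L) → b k = 0) →
      (∃ n : ℕ, 0 < n ∧ (fun i => (n : ℤ) * (tableZ u v b - tableZ u v
        (lpP (Finset.univ.filter fun k => enum u v k ∈ L) Lx)) i) ∈ relLat u v) → deg b ≤ Δ := by
  classical
  intro Lx hLx b hb ⟨n, hn, hmem⟩
  obtain ⟨a, ha, haS, haM⟩ := tuple_of_mem_support_liftG u v hu hv Lx hLx
  set y : Expo →₀ ℕ := Finsupp.mapDomain (enum u v) b with hy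
  have hysupp : y.support ⊆ L := by
    intro e he
    rw [hy, Finsupp.mapDomain_support_of_injective (enum_injective u v), Finset.mem_image] at he
    obtain ⟨k, hk, rfl⟩ := he
    by_contra hkL
    have := hb k (by simp [hkL])
    rw [Finsupp.mem_support_iff] at hk; exact hk this
  have hsat : R10Defs.InSat (fun j => (u j).support ∪ (v j).support) (R10Defs.toZ y - R10Defs.toZ ((msetT a).filter (· ∈ L))) := by
    refine ⟨n, hn, ?_⟩
    have h := toExpoZ_mem_relLattice u v hu hv _ hmem
    have e1 : (fun i => (n : ℤ) * (tableZ u v b - tableZ u v (lpP (Finset.univ.filter fun k => enum u v k ∈ L) Lx)) i) =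
        (n : ℤ) • (tableZ u v b + (-1 : ℤ) • tableZ u v (lpP (Finset.univ.filter fun k => enum u v k ∈ L) Lx)) := by
      funext i; simp only [Pi.smul_apply, Pi.add_apply, Pi.sub_apply, smul_eq_mul]; ring
    rw [e1, toExpoZ_smul, toExpoZ_add, toExpoZ_smul, toExpoZ_tableZ, toExpoZ_tableZ, mapDomain_lpP, ← haM] at h
    have e2 : R10Defs.toZ y - R10Defs.toZ ((msetT a).filter (· ∈ L)) =
        R10Defs.toZ (Finsupp.mapDomain (enum u v) b) +
          (-1 : ℤ) • R10Defs.toZ ((msetT a).filter (· ∈ L)) := by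
      rw [hy, neg_one_smul, sub_eq_add_neg]
    rw [e2]; exact h
  have hmass := hFS a ha y hysupp hsat
  -- mass of y = deg b
  have hdeg : (y.sum fun _ k => k) = deg b := by
    rw [hy, Finsupp.sum_mapDomain_index (fun _ => rfl) (fun _ _ _ => rfl)]; rfl
  rw [hdeg] at hmass; exact hmass

end Bridge

/-! ### The rung -/

/-- **RUNG R10 — `R10Defs.ConfinedTameLaw C`** (val-idea-37 `positive-circuit-chart`; director R275): letter-confined (`#L ≤ Cm`) and tame
(fibre spread `≤ (m+2)^C`) relation lattices obey the per-cell law, with `a = b = 32 (C+3)^2`, for ANY coincidence rank and NO datum.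
Assembled from the chart (`positiveCircuitChart_holds`), the engine (`confinedCount`) and the arithmetic (`arith_R10`).
R275 P3 scope: a PROPER POSITIVE SUB-CASE of the residual — nothing here closes 5906 (`TwoProducts` / `ResidualLawV21` /
`PlanarCellBound` remain OPEN); VP ≠ VNP is NOT proved. [folklore] -/
theorem confinedTameLaw_holds (C : ℕ) : R10Defs.ConfinedTameLaw C := by
  classical
  refine ⟨32 * (C + 3) ^ 2, 32 * (C + 3) ^ 2, ?_⟩
  intro m t ht u v hu hv L hL hLC hFS R S hS
  have hu0 : ∀ j, coeff 0 (u j) = 0 := fun j => (hu j).1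
  have hv0 : ∀ j, coeff 0 (v j) = 0 := fun j => (hv j).1
  set Lι : Finset (Fin (sE u v)) := Finset.univ.filter fun k => enum u v k ∈ L with hLι
  have hLιcard : Lι.card ≤ C * m := by
    have h1 : Lι.card = (Lι.image (enum u v)).card := (Finset.card_image_of_injective _ (enum_injective u v)).symm
    have h2 : Lι.image (enum u v) ⊆ L := by
      intro e he; obtain ⟨k, hk, rfl⟩ := Finset.mem_image.mp he; exact (Finset.mem_filter.mp hk).2
    rw [h1]; exact (Finset.card_le_card h2).trans hL
  have hconf : ∀ z ∈ relLat u v, ∀ k, k ∉ Lι → z k = 0 := fun z hz k hk =>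
    conf_of_letterConfined u v hu0 hv0 L hLC z hz k (by simpa [hLι] using hk)
  have hspread := spread_of_fibreSpread u v hu0 hv0 L ((m + 2) ^ C) hFS
  have hvis : ∀ l ∈ S, ∃ ξ : Fin 2 → ℝ, ValidWeight u v ξ ∧ IsStrictTop ξ ↑(tailDiff u v).support l := fun l hl => by
    obtain ⟨ξ, hval, htop, -⟩ := hS l hl
    exact ⟨ξ, hval, (stub_logLinearisation m u v hu0 hv0 ξ hval l).2 htop⟩
  have hcount := confinedCount (u := u) (v := v) hu0 hv0 Lι hconf ((m + 2) ^ C) hspread S hvis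
  have hsE : sE u v ≤ 2 * m * t := sE_le u v t (fun j => (hu j).2) (fun j => (hv j).2)
  have harith := arith_R10 C m (sE u v) t Lι.card hsE hLιcard
  unfold pencilBd at hcount
  exact hcount.trans harith

end R10
end Summit.ValiantsHypothesis.ValiantsHypothesis.Theorems.NewtonUnitEquations.TwoProducts.PermutationType

end
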